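import Summits.CriticalPhenomena.CardyFormulaZ2.Theses.CardyGluingRDE
import Summits.CriticalPhenomena.CardyFormulaZ2.Theorems.CardyGluingRDEBoxMergingSquareCardy
import Literature.Probability.Percolation.GluingRDE
import Literature.Probability.Percolation.BoxArcStateReading
import Literature.Probability.Percolation.MultiResTVSegments
import Literature.Probability.Percolation.PlanarDuality
import Literature.Probability.Percolation.TriHexLemma
import Literature.Probability.Percolation.ZdNearCriticalWindow
import HarnessLib.Audit

/-!
# Birth skeleton for crux `GluingContraction` (stmt-CriticalPhenomena-8580)

Route `route-CriticalPhenomena-CardyGluingRDE` (sub-problem `CardyFormulaZ2`), crux rank 3 = the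
thesis X of the route: writing `TV_j(u,u')` for the total variation between the bond-`ℤ²` (mesh `u`)
and site-`𝕋` (mesh `u'`) laws of the resolution-`j` segment-connectivity matrix of the square
`(0, δ₀)²` and `Dw_K = Σ_{j ≤ K} 2^(−σj) TV_j`, X asserts (A) LOCAL CONTRACTION of `Dw_K` under
`m`-fold mesh-halving from the lattice-resolution onset `u ≤ δ₀/(C·2^K)`, with slack `C·2^(−κK)`,
and (B) ENTRY of the `ℤ²` orbit into the `ρ/2`-ball.

This file is the registrar's BIRTH SKELETON (re-audit bin HONEST-BET-1LEAF): it types the route's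
own foreseen glued split (route header, TWO-LAYER PLAN (a):
`GluingContraction ⇐ ShadowingDw → GluingStability → AnchorEntry`), which became typable once the
definition requests of the route landed in `Literature/Probability/Percolation/`
(`BoxArcState`/`planarCoinGlue` — `PlanarCoinGlue.lean`; `gluingRDE` — `GluingRDE.lean`;
`readZ`/`readT` — `BoxArcStateReading.lean`; `tvFin`/`multiResSum`/`segMultiResTV` —
`MultiResTV.lean`, `MultiResTVSegments.lean`).

## The mechanism object

`Ψ_k = gluingRDE planarCoinGlue (uniform coins)` (`Psi k`): Langlands' finite-model renormalisation
`Θ_𝔛` on laws of resolution-`k` square states (pairs primal/dual of Boolean "joined inside the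
window" matrices on the `4k` boundary segments), made planar and duality-symmetric by resolving
contested interior arcs with fresh fair coins (the route's correction).  Mesh-halving of the square
IS `Ψ` read on the true laws, up to a SHADOWING error; so clause (A) splits along the triangle
inequality in the multiresolution total variation of the primal coordinates:

  `Dw(ℤ²@u/2^m, 𝕋@u'/2^m) ≤ D(ℤ²@u/2^m, Ψ^m ℤ²@u) + D(Ψ^m ℤ²@u, Ψ^m 𝕋@u') + D(Ψ^m 𝕋@u', 𝕋@u'/2^m)`.

## Stubs (each a genuine lemma of the line; none is the crux or the summit)

1. `stub_shadowingZ` (ShadowingDw, `ℤ²` half; size L): from the lattice-resolution onset the true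
   `ℤ²` law at mesh `u/2^m` is within `C·2^(−κK)` (multiresolution TV of primal coordinates) of the
   `m`-fold glued prediction `Ψ^m(law at mesh u)` — the law-level form of the one-seam shadowing
   estimate `JunctionShadowingT` (crux r4) at the four internal seams, iterated `m` times, plus the
   boundary-layer insensitivity of coarse entries at incommensurable meshes.
2. `stub_shadowingT` (ShadowingDw, `𝕋` half; size L): the same on the triangular lattice,
   eventually in the mesh (`u' ≤ δ_T(δ₀, K)`), i.e. the `𝕋` tail is a `C·2^(−κK)`-pseudo-fixed
   point of `Ψ^m` (Smirnov–Werner `α₄ = 5/4` prices the false junctions).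
3. `stub_psiContraction` (GluingStability read on the true laws; the load-bearing RG statement,
   size open-problem): `Ψ^m` contracts the `ℤ²`–`𝕋` discrepancy by a factor `θ < 1` up to slack
   `C·2^(−κK)`, inside the `ρ`-ball, from the onset — a statement about an EXPLICIT family of
   polynomial self-maps of finite simplices evaluated at the reading laws (numerically testable
   level by level), not about crossing probabilities of other domains.
4. `stub_entry` (AnchorEntry; size XL stand-alone, believed): clause (B) for all parameters — the
   `ℤ²` orbit enters the `ρ/2`-ball around the `𝕋` tail on a full window of meshes below the onset
   (lim-inf universality of the joint segment laws + convergence of the `𝕋` tail; implied by the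
   route's support item `BoxMerging` via the landed `Theorems.BoxMerging_entry`, and strictly
   weaker than it).

`GluingContraction_of : stub₁ → stub₂ → stub₃ → stub₄ → GluingContraction` (hypotheses = the four
stub statements by name, `Statement.stub_* := type_of% stub_*`) is proved below without `sorry` (triangle inequality for `tvFin` at every level, additivity and
monotonicity of `multiResSum`, constants `C' = C + C₁ + C₂`, `κ' = min κ κ₁ κ₂`, `δ_T = min` of the
three onsets).  The only `sorry`s of the file are the four `stub_*`.

Disproof used: none exists for this crux (`ledger crux ls stmt-CriticalPhenomena-8580`: no
workfiles; `ledger negatives`: only the misstated `JunctionShadowing`, stmt-8581, whose `≤`-tie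
witness concerns the seam-relay statement, not the law-level objects used here).
-/

noncomputable section

namespace Summit.CriticalPhenomena.CardyFormulaZ2.Cruxes.GluingContraction.Birth

open scoped BigOperators ENNReal
open MeasureTheory Set
open Literature.Probability.Percolation Literature.Probability.LatticeModels

/-! ### The route's inlined quantities, as definitions (verbatim bodies) -/

/-- Bond percolation on `ℤ²` at `p = 1/2` (the route's `PZ`). -/
abbrev PZ : Measure (BondConfig (Site 2)) := bondPercolation (zdGraph 2) half

/-- Site percolation on the triangular lattice at `p = 1/2` (the route's `PT`). -/
abbrev PT : Measure (SiteConfig (Site 2)) := triSitePercolation half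

/-- The open square window `(0, δ₀)²` (the route's `Sq`; also `Literature…sq`). -/
def Sq (δ₀ : ℝ) : Set ℂ := {z : ℂ | 0 < z.re ∧ z.re < δ₀ ∧ 0 < z.im ∧ z.im < δ₀}

/-- The route's dyadic boundary segment `seg δ₀ j a` (coordinate parametrisation), verbatim. -/
def rseg (δ₀ : ℝ) (j : ℕ) (a : Fin 4 × Fin (2 ^ j)) : Set ℂ :=
  {z : ℂ | (a.1 = 0 ∧ z.im = 0 ∧ δ₀ * ((a.2 : ℕ) : ℝ) / 2 ^ j ≤ z.re ∧
      z.re ≤ δ₀ * (((a.2 : ℕ) : ℝ) + 1) / 2 ^ j) ∨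
    (a.1 = 1 ∧ z.re = δ₀ ∧ δ₀ * ((a.2 : ℕ) : ℝ) / 2 ^ j ≤ z.im ∧
      z.im ≤ δ₀ * (((a.2 : ℕ) : ℝ) + 1) / 2 ^ j) ∨
    (a.1 = 2 ∧ z.im = δ₀ ∧ δ₀ * ((a.2 : ℕ) : ℝ) / 2 ^ j ≤ z.re ∧
      z.re ≤ δ₀ * (((a.2 : ℕ) : ℝ) + 1) / 2 ^ j) ∨
    (a.1 = 3 ∧ z.re = 0 ∧ δ₀ * ((a.2 : ℕ) : ℝ) / 2 ^ j ≤ z.im ∧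
      z.im ≤ δ₀ * (((a.2 : ℕ) : ℝ) + 1) / 2 ^ j)}

/-- The route's state cell `EZ δ₀ j u M` (bond-`ℤ²`, mesh `u`), verbatim. -/
def EZ (δ₀ : ℝ) (j : ℕ) (u : ℝ) (M : SegMatrix (2 ^ j)) : Set (BondConfig (Site 2)) :=
  {ω | ∀ a b, ω ∈ discreteCrossing (Sq δ₀) u (rseg δ₀ j a) (rseg δ₀ j b) ↔ M a b = true}

/-- The route's state cell `ET δ₀ j u' M` (site-`𝕋`, mesh `u'`), verbatim. -/
def ET (δ₀ : ℝ) (j : ℕ) (u' : ℝ) (M : SegMatrix (2 ^ j)) : Set (SiteConfig (Site 2)) :=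
  {ω | ∀ a b, ω ∈ triCrossing (Sq δ₀) u' (rseg δ₀ j a) (rseg δ₀ j b) ↔ M a b = true}

/-- The bond-`ℤ²` reading vector at resolution `j` and mesh `u`: `M ↦ P_ℤ²(EZ M)`. -/
def zVec (δ₀ : ℝ) (j : ℕ) (u : ℝ) : SegMatrix (2 ^ j) → ℝ := fun M => PZ.real (EZ δ₀ j u M)

/-- The site-`𝕋` reading vector at resolution `j` and mesh `u'`: `M ↦ P_𝕋(ET M)`. -/
def tVec (δ₀ : ℝ) (j : ℕ) (u' : ℝ) : SegMatrix (2 ^ j) → ℝ := fun M => PT.real (ET δ₀ j u' M)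

/-- The route's `TV δ₀ j u u'` (definitionally: `tvFin` of the two reading vectors,
`route_TV_eq_tvFin_and_Dw_eq_multiResSum`). -/
def TV (δ₀ : ℝ) (j : ℕ) (u u' : ℝ) : ℝ := tvFin (zVec δ₀ j u) (tVec δ₀ j u')

/-- The route's `Dw σ δ₀ K u u'` (definitionally: `multiResSum σ K (j ↦ TV_j)`). -/
def Dw (σ δ₀ : ℝ) (K : ℕ) (u u' : ℝ) : ℝ := multiResSum σ K fun j => TV δ₀ j u u'

/-! ### The gluing RDE `Ψ`, reading laws, glued predictions -/

/-- **`Ψ_k`**: the planarity-corrected Langlands gluing RDE on laws of resolution-`k` square states,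
`gluingRDE planarCoinGlue (uniform law on the 4k coins)`. -/
def Psi (k : ℕ) : PMF (BoxArcState k) → PMF (BoxArcState k) :=
  gluingRDE (planarCoinGlue (k := k)) (PMF.uniformOfFintype (Fin 4 × Fin k → Bool))

/-- The primal matrix of a state in the ROUTE's coordinate indexing (`toCoord` converts the
counterclockwise positions of `BoxArcState` to the route's coordinate positions; it is an
involution). -/
def primalCoord {k : ℕ} (S : BoxArcState k) : SegMatrix k := fun a b => S.primal (toCoord a) (toCoord b)

/-- Level-`j` coordinates of a law `μ` of resolution-`2^K` states: the real masses of the OR-fusion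
`SegMatrix.coarsen K j` of its primal matrix (route indexing). -/
def lawVec (K j : ℕ) (μ : PMF (BoxArcState (2 ^ K))) : SegMatrix (2 ^ j) → ℝ :=
  fun M => ((μ.map primalCoord).map (SegMatrix.coarsen K j) M).toReal

/-- The empty state (all entries `false`), used only as the value of a junk branch. -/
def emptyState (k : ℕ) : BoxArcState k := ⟨fun _ _ => false, fun _ _ => false⟩

open Classical in
/-- **The bond-`ℤ²` reading law** at resolution `k`, window `(0, δ₀)²`, mesh `u`: the law of
`readZ k δ₀ u` under `P_ℤ²`, i.e. `S ↦ P_ℤ²(stateEventZ k δ₀ u S)` (these masses always sum to `1`,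
`hasSum_stateEventZ`; the `dite` only makes the definition total). -/
def lawZ (k : ℕ) (δ₀ u : ℝ) : PMF (BoxArcState k) :=
  if h : HasSum (fun S => PZ (stateEventZ k δ₀ u S)) 1 then ⟨_, h⟩ else PMF.pure (emptyState k)

open Classical in
/-- **The site-`𝕋` reading law** at resolution `k`, window `(0, δ₀)²`, mesh `u'`: the law of
`readT k δ₀ u'` under `P_𝕋`, `S ↦ P_𝕋(stateEventT k δ₀ u' S)` (masses sum to `1` for `u' > 0`,
`hasSum_stateEventT`). -/
def lawT (k : ℕ) (δ₀ u' : ℝ) : PMF (BoxArcState k) :=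
  if h : HasSum (fun S => PT (stateEventT k δ₀ u' S)) 1 then ⟨_, h⟩ else PMF.pure (emptyState k)

/-- **Glued `ℤ²` prediction**: `Ψ^m` applied to the `ℤ²` reading law at mesh `u`, top resolution `2^K`
(the model of `m` mesh-halvings of the square). -/
def predZ (K m : ℕ) (δ₀ u : ℝ) : PMF (BoxArcState (2 ^ K)) := (Psi (2 ^ K))^[m] (lawZ (2 ^ K) δ₀ u)

/-- **Glued `𝕋` prediction**: `Ψ^m` applied to the `𝕋` reading law at mesh `u'`. -/
def predT (K m : ℕ) (δ₀ u' : ℝ) : PMF (BoxArcState (2 ^ K)) := (Psi (2 ^ K))^[m] (lawT (2 ^ K) δ₀ u')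

/-! ### The four registered stubs -/

/-- **STUB 1 — `ℤ²` shadowing from the lattice-resolution onset** (ShadowingDw, `ℤ²` half): for
every `m ≥ 1` and rate `σ > 0` there are `C, κ > 0` such that for every window `δ₀`, top
resolution `K` and `ℤ²`-mesh `u ≤ δ₀/(C·2^K)`, the true `ℤ²` law at mesh `u/2^m` is within
`C·2^(−κK)` (multiresolution total variation of the primal coordinates) of the glued prediction
`Ψ^m(ℤ² law at mesh u)` — the law-level one-step closure fed by `JunctionShadowingT` at the four
internal seams, iterated `m` times, plus boundary-layer insensitivity at incommensurable meshes. -/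
theorem stub_shadowingZ :
    ∀ m : ℕ, 1 ≤ m → ∀ σ : ℝ, 0 < σ → ∃ C κ : ℝ, 0 < C ∧ 0 < κ ∧
      ∀ δ₀ : ℝ, 0 < δ₀ → ∀ (K : ℕ) (u : ℝ), 0 < u → u ≤ δ₀ / (C * 2 ^ K) →
        multiResSum σ K (fun j => tvFin (zVec δ₀ j (u / 2 ^ m)) (lawVec K j (predZ K m δ₀ u)))
          ≤ C * (2 : ℝ) ^ (-(κ * (K : ℝ))) := by
  sorry

/-- **STUB 2 — `𝕋` shadowing, eventually in the mesh** (ShadowingDw, `𝕋` half): the same closure on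
the triangular lattice for `0 < u' ≤ δ_T(δ₀, K)`; in the limit `u' → 0` it says the `𝕋` tail is a
`C·2^(−κK)`-pseudo-fixed point of `Ψ^m` at top resolution `2^K`. -/
theorem stub_shadowingT :
    ∀ m : ℕ, 1 ≤ m → ∀ σ : ℝ, 0 < σ → ∃ C κ : ℝ, 0 < C ∧ 0 < κ ∧
      ∀ δ₀ : ℝ, 0 < δ₀ → ∀ K : ℕ, ∃ δT : ℝ, 0 < δT ∧ ∀ u' : ℝ, 0 < u' → u' ≤ δT →
        multiResSum σ K (fun j => tvFin (lawVec K j (predT K m δ₀ u')) (tVec δ₀ j (u' / 2 ^ m)))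
          ≤ C * (2 : ℝ) ^ (-(κ * (K : ℝ))) := by
  sorry

/-- **STUB 3 — `Ψ^m` contracts the `ℤ²`–`𝕋` discrepancy** (GluingStability read on the true laws;
load-bearing): for some rate `σ`, factor `θ < 1`, constants `C, κ, ρ` and step `m`, from the
lattice-resolution onset and eventually in the `𝕋`-mesh, whenever the route's discrepancy
`Dw_K(u,u') ≤ ρ`, the glued predictions are closer by the factor `θ` up to slack `C·2^(−κK)`:
`D(Ψ^m ℤ²@u, Ψ^m 𝕋@u') ≤ θ·Dw_K(u,u') + C·2^(−κK)`. -/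
theorem stub_psiContraction :
    ∃ σ θ C κ ρ : ℝ, ∃ m : ℕ, 0 < σ ∧ 0 ≤ θ ∧ θ < 1 ∧ 0 < C ∧ 0 < κ ∧ 0 < ρ ∧ 1 ≤ m ∧
      ∀ δ₀ : ℝ, 0 < δ₀ → ∀ K : ℕ, ∃ δT : ℝ, 0 < δT ∧
        ∀ u u' : ℝ, 0 < u → u ≤ δ₀ / (C * 2 ^ K) → 0 < u' → u' ≤ δT → Dw σ δ₀ K u u' ≤ ρ →
          multiResSum σ K
              (fun j => tvFin (lawVec K j (predZ K m δ₀ u)) (lawVec K j (predT K m δ₀ u')))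
            ≤ θ * Dw σ δ₀ K u u' + C * (2 : ℝ) ^ (-(κ * (K : ℝ))) := by
  sorry

/-- **STUB 4 — entry** (AnchorEntry): clause (B) of the crux for ALL parameters — for every
`σ, C, ρ > 0`, `m ≥ 1`, `δ₀ > 0`, `K` there are a `𝕋`-onset `δ_T` and a `ℤ²`-mesh
`0 < u_Z ≤ δ₀/(C·2^K)` with `Dw_K(u,u') ≤ ρ/2` on the window `u ∈ [u_Z/2^m, u_Z]`, `0 < u' ≤ δ_T`
(lim-inf universality of the joint segment laws + convergence of the `𝕋` tail; implied by the
support item `BoxMerging` through the landed `Theorems.BoxMerging_entry`, strictly weaker than it). -/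
theorem stub_entry :
    ∀ σ : ℝ, 0 < σ → ∀ C : ℝ, 0 < C → ∀ ρ : ℝ, 0 < ρ → ∀ m : ℕ, 1 ≤ m → ∀ δ₀ : ℝ, 0 < δ₀ →
      ∀ K : ℕ, ∃ δT : ℝ, 0 < δT ∧ ∃ uZ : ℝ, 0 < uZ ∧ uZ ≤ δ₀ / (C * 2 ^ K) ∧
        ∀ u u' : ℝ, uZ / 2 ^ m ≤ u → u ≤ uZ → 0 < u' → u' ≤ δT → Dw σ δ₀ K u u' ≤ ρ / 2 := by
  sorry

/-! ### The stub STATEMENTS under the stubs' own short names (hypotheses of `GluingContraction_of`)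

The layer-invariant audit (`#h21_check_skeleton`) admits, as hypotheses of the theorem concluding the
crux, only registered obligations BY NAME; `Statement.stub_x := type_of% stub_x` is the statement of
the registered stub `stub_x` under the same short name (no `sorry` is inherited: only the TYPE of the
stub is used). -/

namespace Statement

/-- Statement of STUB 1 (`ℤ²` shadowing). -/
abbrev stub_shadowingZ : Prop :=
  type_of% Summit.CriticalPhenomena.CardyFormulaZ2.Cruxes.GluingContraction.Birth.stub_shadowingZ

/-- Statement of STUB 2 (`𝕋` shadowing). -/
abbrev stub_shadowingT : Prop :=
  type_of% Summit.CriticalPhenomena.CardyFormulaZ2.Cruxes.GluingContraction.Birth.stub_shadowingT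

/-- Statement of STUB 3 (`Ψ^m` contraction). -/
abbrev stub_psiContraction : Prop :=
  type_of% Summit.CriticalPhenomena.CardyFormulaZ2.Cruxes.GluingContraction.Birth.stub_psiContraction

/-- Statement of STUB 4 (entry). -/
abbrev stub_entry : Prop :=
  type_of% Summit.CriticalPhenomena.CardyFormulaZ2.Cruxes.GluingContraction.Birth.stub_entry

end Statement

/-! ### Assembly: the four stubs give the crux (no `sorry` below this line) -/

/-- Geometric slack comparison: `2^(−κ₁K) ≤ 2^(−κ'K)` when `κ' ≤ κ₁`. -/
theorem rpow_slack_mono {κ' κ₁ : ℝ} (h : κ' ≤ κ₁) (K : ℕ) :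
    (2 : ℝ) ^ (-(κ₁ * (K : ℝ))) ≤ (2 : ℝ) ^ (-(κ' * (K : ℝ))) :=
  Real.rpow_le_rpow_of_exponent_le (by norm_num)
    (neg_le_neg (mul_le_mul_of_nonneg_right h (Nat.cast_nonneg K)))

/-- Onset comparison: a larger onset constant gives a smaller onset mesh. -/
theorem onset_mono {δ₀ C C' : ℝ} (hδ₀ : 0 ≤ δ₀) (hC : 0 < C) (hCC' : C ≤ C') (K : ℕ) :
    δ₀ / (C' * 2 ^ K) ≤ δ₀ / (C * 2 ^ K) :=
  div_le_div_of_nonneg_left hδ₀ (by positivity) (mul_le_mul_of_nonneg_right hCC' (by positivity))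

/-- Three-point triangle inequality for `tvFin`, summed with the multiresolution weights. -/
theorem multiResSum_tvFin_triangle3 (σ : ℝ) (K : ℕ) (A B Cc D : (j : ℕ) → SegMatrix (2 ^ j) → ℝ) :
    multiResSum σ K (fun j => tvFin (A j) (D j)) ≤
      multiResSum σ K (fun j => tvFin (A j) (B j)) +
        multiResSum σ K (fun j => tvFin (B j) (Cc j)) +
        multiResSum σ K (fun j => tvFin (Cc j) (D j)) := by
  rw [← multiResSum_add, ← multiResSum_add]
  exact multiResSum_mono fun j _ => by
    linarith [tvFin_triangle (A j) (B j) (D j), tvFin_triangle (B j) (Cc j) (D j)]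

/-- **The crux from the stubs** (`GluingContraction_of : stub₁ → stub₂ → stub₃ → stub₄ →
GluingContraction`, hypotheses = the four stub statements by name, `Statement.stub_*`): clause (A) by
the triangle
inequality for `tvFin` at every resolution through the two glued predictions, with constants
`C' = C + C₁ + C₂`, `κ' = min κ (min κ₁ κ₂)`, `δ_T = min` of the three onsets; clause (B) from the
entry stub at the enlarged onset constant `C'`. -/
theorem GluingContraction_of (h₁ : Statement.stub_shadowingZ) (h₂ : Statement.stub_shadowingT)
    (h₃ : Statement.stub_psiContraction) (h₄ : Statement.stub_entry) :
    Summit.CriticalPhenomena.CardyFormulaZ2.Theses.CardyGluingRDE.GluingContraction := by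
  obtain ⟨σ, θ, C, κ, ρ, m, hσ, hθ0, hθ1, hC, hκ, hρ, hm, H3⟩ := h₃
  obtain ⟨C₁, κ₁, hC₁, hκ₁, H1⟩ := h₁ m hm σ hσ
  obtain ⟨C₂, κ₂, hC₂, hκ₂, H2⟩ := h₂ m hm σ hσ
  have hC' : 0 < C + C₁ + C₂ := add_pos (add_pos hC hC₁) hC₂
  have hκ' : 0 < min κ (min κ₁ κ₂) := lt_min hκ (lt_min hκ₁ hκ₂)
  -- the main claim, in the notation of this file (definitionally the route's `let`s)
  have key : ∃ σ θ C κ ρ : ℝ, ∃ m : ℕ, 0 < σ ∧ 0 ≤ θ ∧ θ < 1 ∧ 0 < C ∧ 0 < κ ∧ 0 < ρ ∧ 1 ≤ m ∧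
      ∀ δ₀ : ℝ, 0 < δ₀ → ∀ K : ℕ, ∃ δT : ℝ, 0 < δT ∧
        (∀ u u' : ℝ, 0 < u → u ≤ δ₀ / (C * 2 ^ K) → 0 < u' → u' ≤ δT → Dw σ δ₀ K u u' ≤ ρ →
          Dw σ δ₀ K (u / 2 ^ m) (u' / 2 ^ m) ≤ θ * Dw σ δ₀ K u u' + C * (2 : ℝ) ^ (-(κ * (K : ℝ)))) ∧
        (∃ uZ : ℝ, 0 < uZ ∧ uZ ≤ δ₀ / (C * 2 ^ K) ∧ ∀ u u' : ℝ, uZ / 2 ^ m ≤ u → u ≤ uZ →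
          0 < u' → u' ≤ δT → Dw σ δ₀ K u u' ≤ ρ / 2) := by
    refine ⟨σ, θ, C + C₁ + C₂, min κ (min κ₁ κ₂), ρ, m, hσ, hθ0, hθ1, hC', hκ', hρ, hm,
      fun δ₀ hδ₀ K => ?_⟩
    obtain ⟨δT₃, hδT₃, hA3⟩ := H3 δ₀ hδ₀ K
    obtain ⟨δT₂, hδT₂, hS2⟩ := H2 δ₀ hδ₀ K
    obtain ⟨δT₄, hδT₄, uZ, huZ, huZle, hB⟩ := h₄ σ hσ (C + C₁ + C₂) hC' ρ hρ m hm δ₀ hδ₀ K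
    refine ⟨min δT₃ (min δT₂ δT₄), lt_min hδT₃ (lt_min hδT₂ hδT₄), ?_, uZ, huZ, huZle, ?_⟩
    · intro u u' hu hule hu' hu'le hDw
      have huC : u ≤ δ₀ / (C * 2 ^ K) :=
        hule.trans (onset_mono hδ₀.le hC (by linarith) K)
      have huC₁ : u ≤ δ₀ / (C₁ * 2 ^ K) :=
        hule.trans (onset_mono hδ₀.le hC₁ (by linarith) K)
      have e3 := hA3 u u' hu huC hu' (hu'le.trans (min_le_left _ _)) hDw
      have e1 := H1 δ₀ hδ₀ K u hu huC₁
      have e2 := hS2 u' hu' (hu'le.trans ((min_le_right _ _).trans (min_le_left _ _)))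
      have tri := multiResSum_tvFin_triangle3 σ K (fun j => zVec δ₀ j (u / 2 ^ m))
        (fun j => lawVec K j (predZ K m δ₀ u)) (fun j => lawVec K j (predT K m δ₀ u'))
        (fun j => tVec δ₀ j (u' / 2 ^ m))
      beta_reduce at tri
      have hDwdef : Dw σ δ₀ K (u / 2 ^ m) (u' / 2 ^ m) =
          multiResSum σ K (fun j => tvFin (zVec δ₀ j (u / 2 ^ m)) (tVec δ₀ j (u' / 2 ^ m))) :=
        rfl
      have s1 : (2 : ℝ) ^ (-(κ₁ * (K : ℝ))) ≤ (2 : ℝ) ^ (-(min κ (min κ₁ κ₂) * (K : ℝ))) :=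
        rpow_slack_mono ((min_le_right _ _).trans (min_le_left _ _)) K
      have s2 : (2 : ℝ) ^ (-(κ₂ * (K : ℝ))) ≤ (2 : ℝ) ^ (-(min κ (min κ₁ κ₂) * (K : ℝ))) :=
        rpow_slack_mono ((min_le_right _ _).trans (min_le_right _ _)) K
      have s3 : (2 : ℝ) ^ (-(κ * (K : ℝ))) ≤ (2 : ℝ) ^ (-(min κ (min κ₁ κ₂) * (K : ℝ))) :=
        rpow_slack_mono (min_le_left _ _) K
      have m1 := mul_le_mul_of_nonneg_left s1 hC₁.le
      have m2 := mul_le_mul_of_nonneg_left s2 hC₂.le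
      have m3 := mul_le_mul_of_nonneg_left s3 hC.le
      linarith [tri, hDwdef, e1, e2, e3, m1, m2, m3]
    · intro u u' hu1 hu2 hu' hu'le
      exact hB u u' hu1 hu2 hu' (hu'le.trans ((min_le_right _ _).trans (min_le_right _ _)))
  exact key

/-! ### Sanity of the reading laws: the `dite`s take their first branch -/

/-- The Boolean indicator of a measurable predicate is measurable. -/
theorem measurable_decide_pred {Ω : Type*} [MeasurableSpace Ω] {p : Ω → Prop} [DecidablePred p]
    (hp : MeasurableSet {ω | p ω}) : Measurable fun ω => decide (p ω) := by
  refine measurable_to_countable' fun b => ?_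
  cases b
  · have : (fun ω => decide (p ω)) ⁻¹' {false} = {ω | p ω}ᶜ := by
      ext ω; simp
    rw [this]; exact hp.compl
  · have : (fun ω => decide (p ω)) ⁻¹' {true} = {ω | p ω} := by
      ext ω; simp
    rw [this]; exact hp

/-- A map into `BoxArcState k` whose two matrix-valued components have measurable Boolean entries
is measurable (the σ-algebra on `BoxArcState k` is discrete, the state space finite). -/
theorem measurable_boxArcState_mk {Ω : Type*} [MeasurableSpace Ω] {k : ℕ}
    (P D : Ω → ArcRel k) (hP : ∀ a b, Measurable fun ω => P ω a b)
    (hD : ∀ a b, Measurable fun ω => D ω a b) :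
    Measurable fun ω => (⟨P ω, D ω⟩ : BoxArcState k) := by
  have hG : Measurable fun ω => (P ω, D ω) :=
    (measurable_pi_lambda _ fun a => measurable_pi_lambda _ fun b => hP a b).prodMk
      (measurable_pi_lambda _ fun a => measurable_pi_lambda _ fun b => hD a b)
  refine measurable_to_countable' fun S => ?_
  have : (fun ω => (⟨P ω, D ω⟩ : BoxArcState k)) ⁻¹' {S} =
      (fun ω => (P ω, D ω)) ⁻¹' {(S.primal, S.dual)} := by
    ext ω
    simp [BoxArcState.ext_iff]
  rw [this]
  exact hG (measurableSet_singleton _)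

/-- `readZ k δ₀ u` is measurable (every mesh `u`). -/
theorem measurable_readZ (k : ℕ) (δ₀ u : ℝ) : Measurable (readZ k δ₀ u) := by
  classical
  unfold readZ
  refine measurable_boxArcState_mk _ _ (fun a b => ?_) (fun a b => ?_)
  · exact measurable_decide_pred
      (measurableSet_discreteCrossing (sq δ₀) u (ccwSeg δ₀ k a) (ccwSeg δ₀ k b))
  · exact measurable_decide_pred
      (measurable_dualConfig (measurableSet_discreteCrossing (dualWindow u (sq δ₀)) u
        (dualWindow u (ccwSeg δ₀ k a)) (dualWindow u (ccwSeg δ₀ k b))))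

/-- The window is bounded. -/
theorem isBounded_sq (δ₀ : ℝ) : Bornology.IsBounded (sq δ₀) := by
  refine (Metric.isBounded_closedBall (x := (0 : ℂ)) (r := |δ₀| + |δ₀|)).subset fun z hz' => ?_
  have hz : 0 < z.re ∧ z.re < δ₀ ∧ 0 < z.im ∧ z.im < δ₀ := hz'
  rw [Metric.mem_closedBall, dist_zero_right]
  calc ‖z‖ ≤ |z.re| + |z.im| := Complex.norm_le_abs_re_add_abs_im z
    _ ≤ |δ₀| + |δ₀| := add_le_add
        (by rw [abs_of_pos hz.1]; exact hz.2.1.le.trans (le_abs_self δ₀))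
        (by rw [abs_of_pos hz.2.2.1]; exact hz.2.2.2.le.trans (le_abs_self δ₀))

/-- `readT k δ₀ u'` is measurable for `u' > 0`. -/
theorem measurable_readT (k : ℕ) (δ₀ : ℝ) {u' : ℝ} (hu' : 0 < u') : Measurable (readT k δ₀ u') := by
  classical
  unfold readT
  refine measurable_boxArcState_mk _ _ (fun a b => ?_) (fun a b => ?_)
  · exact measurable_decide_pred
      (Summit.CriticalPhenomena.CardyFormulaZ2.Theorems.BoxMerging_measurableSet_triCrossing
        (Ω := sq δ₀) (isBounded_sq δ₀) hu' (ccwSeg δ₀ k a) (ccwSeg δ₀ k b))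
  · exact measurable_decide_pred
      ((SiteConfig.complEquiv (Site 2)).measurable
        (Summit.CriticalPhenomena.CardyFormulaZ2.Theorems.BoxMerging_measurableSet_triCrossing
          (Ω := sq δ₀) (isBounded_sq δ₀) hu' (ccwSeg δ₀ k a) (ccwSeg δ₀ k b)))

/-- The fibre masses of a measurable map into a finite discrete space sum to `1`. -/
theorem hasSum_fibre {Ω S : Type*} [MeasurableSpace Ω] [MeasurableSpace S]
    [MeasurableSingletonClass S] [Fintype S] (μ : Measure Ω) [IsProbabilityMeasure μ] {f : Ω → S}
    (hf : Measurable f) : HasSum (fun s => μ (f ⁻¹' {s})) 1 := by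
  have h := hasSum_fintype fun s => μ (f ⁻¹' {s})
  have htot : ∑ s, μ (f ⁻¹' {s}) = 1 := by
    rw [← measure_biUnion_finset (fun s _ t _ hst => ?_) fun s _ => hf (measurableSet_singleton s)]
    · have : (⋃ s ∈ (Finset.univ : Finset S), f ⁻¹' {s}) = univ :=
        eq_univ_of_forall fun ω => mem_iUnion₂.2 ⟨f ω, Finset.mem_univ _, rfl⟩
      rw [this, measure_univ]
    · exact Set.disjoint_iff.2 fun ω ⟨h₁, h₂⟩ => hst ((mem_singleton_iff.1 h₁).symm.trans h₂)
  rwa [htot] at h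

/-- The `ℤ²` state masses sum to `1` (every mesh). -/
theorem hasSum_stateEventZ (k : ℕ) (δ₀ u : ℝ) :
    HasSum (fun S => PZ (stateEventZ k δ₀ u S)) 1 :=
  hasSum_fibre PZ (measurable_readZ k δ₀ u)

/-- The `𝕋` state masses sum to `1` (`u' > 0`). -/
theorem hasSum_stateEventT (k : ℕ) (δ₀ : ℝ) {u' : ℝ} (hu' : 0 < u') :
    HasSum (fun S => PT (stateEventT k δ₀ u' S)) 1 :=
  hasSum_fibre PT (measurable_readT k δ₀ hu')

/-- **`lawZ` is the reading law**: `lawZ k δ₀ u S = P_ℤ²(stateEventZ k δ₀ u S)`. -/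
theorem lawZ_apply (k : ℕ) (δ₀ u : ℝ) (S : BoxArcState k) :
    lawZ k δ₀ u S = PZ (stateEventZ k δ₀ u S) := by
  rw [lawZ, dif_pos (hasSum_stateEventZ k δ₀ u)]
  rfl

/-- **`lawT` is the reading law** for `u' > 0`: `lawT k δ₀ u' S = P_𝕋(stateEventT k δ₀ u' S)`. -/
theorem lawT_apply (k : ℕ) (δ₀ : ℝ) {u' : ℝ} (hu' : 0 < u') (S : BoxArcState k) :
    lawT k δ₀ u' S = PT (stateEventT k δ₀ u' S) := by
  rw [lawT, dif_pos (hasSum_stateEventT k δ₀ hu')]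
  rfl

/-- The route's inlined `TV`/`Dw` ARE this file's `TV`/`Dw` (by `rfl`, as in
`Literature…route_TV_eq_tvFin_and_Dw_eq_multiResSum`): the `let`-prelude of `GluingContraction`,
verbatim, followed by the two identities. -/
theorem route_Dw_eq :
    let PZ := Literature.Probability.Percolation.bondPercolation
      (Literature.Probability.LatticeModels.zdGraph 2) Literature.Probability.Percolation.half
    let PT := Literature.Probability.LatticeModels.triSitePercolation
      Literature.Probability.Percolation.half
    let Sq : ℝ → Set ℂ := fun δ₀ => {z : ℂ | 0 < z.re ∧ z.re < δ₀ ∧ 0 < z.im ∧ z.im < δ₀}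
    let seg : (δ₀ : ℝ) → (j : ℕ) → Fin 4 × Fin (2 ^ j) → Set ℂ := fun δ₀ j a =>
      {z : ℂ | (a.1 = 0 ∧ z.im = 0 ∧ δ₀ * ((a.2 : ℕ) : ℝ) / 2 ^ j ≤ z.re ∧
          z.re ≤ δ₀ * (((a.2 : ℕ) : ℝ) + 1) / 2 ^ j) ∨
        (a.1 = 1 ∧ z.re = δ₀ ∧ δ₀ * ((a.2 : ℕ) : ℝ) / 2 ^ j ≤ z.im ∧
          z.im ≤ δ₀ * (((a.2 : ℕ) : ℝ) + 1) / 2 ^ j) ∨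
        (a.1 = 2 ∧ z.im = δ₀ ∧ δ₀ * ((a.2 : ℕ) : ℝ) / 2 ^ j ≤ z.re ∧
          z.re ≤ δ₀ * (((a.2 : ℕ) : ℝ) + 1) / 2 ^ j) ∨
        (a.1 = 3 ∧ z.re = 0 ∧ δ₀ * ((a.2 : ℕ) : ℝ) / 2 ^ j ≤ z.im ∧
          z.im ≤ δ₀ * (((a.2 : ℕ) : ℝ) + 1) / 2 ^ j)}
    let EZ : (δ₀ : ℝ) → (j : ℕ) → ℝ → ((Fin 4 × Fin (2 ^ j)) → (Fin 4 × Fin (2 ^ j)) → Bool) →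
        Set (Literature.Probability.Percolation.BondConfig
          (Literature.Probability.LatticeModels.Site 2)) := fun δ₀ j u M =>
      {ω | ∀ a b, ω ∈ Literature.Probability.Percolation.discreteCrossing (Sq δ₀) u (seg δ₀ j a)
        (seg δ₀ j b) ↔ M a b = true}
    let ET : (δ₀ : ℝ) → (j : ℕ) → ℝ → ((Fin 4 × Fin (2 ^ j)) → (Fin 4 × Fin (2 ^ j)) → Bool) →
        Set (Literature.Probability.Percolation.SiteConfig
          (Literature.Probability.LatticeModels.Site 2)) := fun δ₀ j u M =>
      {ω | ∀ a b, ω ∈ Literature.Probability.LatticeModels.triCrossing (Sq δ₀) u (seg δ₀ j a)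
        (seg δ₀ j b) ↔ M a b = true}
    let TV' : ℝ → ℕ → ℝ → ℝ → ℝ := fun δ₀ j u u' => (1 / 2 : ℝ) *
      ∑ M : (Fin 4 × Fin (2 ^ j)) → (Fin 4 × Fin (2 ^ j)) → Bool,
        |PZ.real (EZ δ₀ j u M) - PT.real (ET δ₀ j u' M)|
    let Dw' : ℝ → ℝ → ℕ → ℝ → ℝ → ℝ := fun σ δ₀ K u u' =>
      ∑ j ∈ Finset.range (K + 1), (2 : ℝ) ^ (-(σ * (j : ℝ))) * TV' δ₀ j u u'
    (∀ (δ₀ : ℝ) (j : ℕ) (u u' : ℝ), TV' δ₀ j u u' = TV δ₀ j u u') ∧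
    (∀ (σ δ₀ : ℝ) (K : ℕ) (u u' : ℝ), Dw' σ δ₀ K u u' = Dw σ δ₀ K u u') :=
  ⟨fun _ _ _ _ => rfl, fun _ _ _ _ _ => rfl⟩

end Summit.CriticalPhenomena.CardyFormulaZ2.Cruxes.GluingContraction.Birth

end
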